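import Summits.QuantumFields.YangMills.Theorems.BalabanLadderNTMarkovMirrorBareConverse
import HarnessLib

/-!
# Crux `UVSeamRec` (stmt-QuantumFields-20043), stub `stub_floorsEngine` (S-B) / crux `NT` clause (i):
# the clause-(i) package {MF, RBLΔ} with the chirality defect in MEASURE-TYPICAL (`L²(μ_T)`) form

Helper file (`--supports stmt-QuantumFields-20043`) of the seam stub-prover row `ym-20043-seam-s1` (owner RULING
R75), sequel of `…NTMarkovMirrorBare` / `…BareConverse`.  Those files reduced the clause-(i) package of the
Markov–mirror line to {RBLΔ, MF} with the chirality-defect response bound (RBLΔ) in SUP form over exteriors: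
`sup_ζ |kerE_{Q}^ζ(Wᴿ) − kerE_Q^ζ(Ṽ) − p'| ≤ √ε/2`.  The fleet lead's kit finding (ym-spine-20043-p1 g7,
FINDING-20043-g7: self-dual uniform-flux exteriors below the Nielsen–Olesen threshold penetrate a cube with a flat
profile) cautions against typing ANY engine supplier as a `∀`-exterior law; the mirror argument, however, never needs
the sup: the remainder `D = (kerE_Q(Wᴿ) − kerE_Q(Ṽ) − p')∘lift` enters only through the diagonal entry
`B(D, D) = ∫ D∘ϑ·D − (∫D)²` of the Osterwalder–Schrader form, and `B(D, D) ≤ ‖D‖²_{L²(μ_T)}` (`mirrorForm_le_l2sq`,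
AM–GM + `ϑ`-invariance).  Hence the measure-typical package, per coupling and torus:

* (MF)      `X ≤ Cov_T(Ṽ_v∘Θ₀, Ṽ_v)` — bare mirror floor of the smeared density carried by the cube;
* (RBLΔ-L²) `∫ |kerE_Q^{lift U}(Wᴿ_v) − kerE_Q^{lift U}(Ṽ_v) − p'|² dμ_T(U) ≤ ε/4` — the chirality-defect response is
  small IN MEAN SQUARE under Wilson's torus measure (implied by the sup form; fed, e.g., by second moments of the
  boundary influences of the electric plane fields — a ceilings-type datum);

gives `ε ≤ Q2(θv, v)` from `X = 9ε/4` (`Q2_ge_of_bareFloor_l2`), and conversely `ε ≤ Q2(θv, v)` gives (MF) with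
`X = ε/2` (`bareFloor_of_Q2_floor_l2`).  The asymptotic packaging along a unit map (clause (i), the two-point
conjunct of the registered `UVSeamRec.stub_floorsEngine`, `NT` by name) is the sequel `…BareTypicalPackage`.
Nothing here is `SU(2)`-specific.  Honest status: bookkeeping; (MF),
(RBLΔ-L²)'s supplier and clause (ii) are engine-grade (crux `NT` / E0′-type ceilings).
-/

set_option autoImplicit false

noncomputable section

open scoped SchwartzMap
open MeasureTheory Filter Topology
open Literature.MathematicalPhysics.QuantumFieldTheory Literature.MathematicalPhysics.QuantumLattice
open Literature.Probability.LatticeModels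
open Summit.QuantumFields.YangMills.Cruxes.OSLegsFromFemtoAndGap.DlrCollarTransfer
open Summit.QuantumFields.YangMills.Cruxes.OSLegsFromFemtoAndGap.DlrCollarTransfer.StubLower (mem_cubeSites_iff)
open Summit.QuantumFields.YangMills.Cruxes.NT.Reference (continuous_kerE continuous_kerE_torusLift)
open Summit.QuantumFields.YangMills.Cruxes.NT.BoundaryLaw (abs_kerE_le)
open Summit.QuantumFields.YangMills.Cruxes.NT.Reflection (sq_cov_negReflect_le_odd_pos integrable_wilson_of_bdd)
open Summit.QuantumFields.YangMills.Theorems.CurvatureKernel (OddTorusCovCauchySchwarz)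

namespace Summit.QuantumFields.YangMills.Cruxes.NT.MarkovMirror

/-! ## §1 The diagonal of the mirror form is below the mean square -/

section Form

variable {G : Type} [Group G] [TopologicalSpace G] [IsTopologicalGroup G] [CompactSpace G]
  [MeasurableSpace G] [BorelSpace G] {N T : ℕ} [NeZero T] (ρ : G →* Matrix (Fin N) (Fin N) ℂ)

/-- **`B(D, D) ≤ ‖D‖²_{L²}`.**  On the torus with Wilson's measure and `ϑ = GaugeConfig.negReflect` (measure
preserving), for bounded measurable real `D`: `∫ D∘ϑ · D − (∫D)² ≤ ∫ D²` (pointwise `D(ϑU)D(U) ≤ (D(ϑU)² + D(U)²)/2`,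
`ϑ`-invariance, and `(∫D)² ≥ 0`). [folklore] -/
theorem mirrorForm_le_l2sq (hρ : Continuous ρ) (β : ℝ) {D : GaugeConfig 4 T G → ℝ} (hD : Measurable D) {K : ℝ}
    (bD : ∀ U, |D U| ≤ K) :
    (∫ U, D U.negReflect * D U ∂(wilsonMeasure ρ β)) - (∫ U, D U ∂(wilsonMeasure ρ β)) ^ 2 ≤
      ∫ U, D U ^ 2 ∂(wilsonMeasure ρ β) := by
  haveI := isProbabilityMeasure_wilsonMeasure (d := 4) (L := T) ρ hρ β
  set μ : Measure (GaugeConfig 4 T G) := wilsonMeasure (d := 4) (L := T) ρ β with hμ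
  have hϑ : Measurable (GaugeConfig.negReflect : GaugeConfig 4 T G → GaugeConfig 4 T G) :=
    WilsonSiteRP.measurable_negReflect
  have hK : 0 ≤ K := (abs_nonneg _).trans (bD (fun _ => 1))
  have bsq : ∀ U, |D U ^ 2| ≤ K ^ 2 := fun U => by
    rw [abs_pow]; exact pow_le_pow_left₀ (abs_nonneg _) (bD U) 2
  have iDD : Integrable (fun U => D U.negReflect * D U) μ :=
    integrable_wilson_of_bdd ρ hρ β ((hD.comp hϑ).mul hD) ⟨K * K, fun U => by
      rw [abs_mul]; exact mul_le_mul (bD _) (bD _) (abs_nonneg _) hK⟩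
  have iD2 : Integrable (fun U => D U ^ 2) μ := integrable_wilson_of_bdd ρ hρ β (hD.pow_const 2) ⟨K ^ 2, bsq⟩
  have iDϑ2 : Integrable (fun U => D U.negReflect ^ 2) μ :=
    integrable_wilson_of_bdd ρ hρ β ((hD.comp hϑ).pow_const 2) ⟨K ^ 2, fun U => bsq _⟩
  have isum : Integrable (fun U => D U.negReflect ^ 2 + D U ^ 2) μ := iDϑ2.add iD2
  have ig : Integrable (fun U => (D U.negReflect ^ 2 + D U ^ 2) / 2) μ := isum.div_const 2
  have hinv : ∫ U, D U.negReflect ^ 2 ∂μ = ∫ U, D U ^ 2 ∂μ :=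
    integral_comp_negReflect_eq (d := 4) (L := T) ρ hρ β (fun U => D U ^ 2)
  have hle : ∀ U, D U.negReflect * D U ≤ (D U.negReflect ^ 2 + D U ^ 2) / 2 := fun U => by
    nlinarith [sq_nonneg (D U.negReflect - D U)]
  have hmono : ∫ U, D U.negReflect * D U ∂μ ≤ ∫ U, (D U.negReflect ^ 2 + D U ^ 2) / 2 ∂μ :=
    integral_mono iDD ig hle
  have hsum : ∫ U, (D U.negReflect ^ 2 + D U ^ 2) / 2 ∂μ = ∫ U, D U ^ 2 ∂μ := by
    rw [integral_div, integral_add iDϑ2 iD2, hinv]; ring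
  have h2 := sq_nonneg (∫ U, D U ∂μ)
  linarith

end Form

/-! ## §2 The chiral mirror floor and its converse with the defect in mean square, per coupling and torus -/

section Typical

variable (G : Type) [Group G] [TopologicalSpace G] [IsTopologicalGroup G] [CompactSpace G]
  [MeasurableSpace G] [BorelSpace G] (r : LatticeRep G)

/-- **The chiral mirror floor from {MF, RBLΔ-L²} (fixed `β ≥ 0`, torus `2L+1`).**  A cube `Q = (c, b)` at times
`≥ 1` with its closed collar inside the window; a spacing `s` and a test function `v` whose lattice support lies in
`Q` at depth `≥ 2`; `Ṽ = ∑_y v(s·y) dens_y`, `Wᴿ` the reflected-species smearing; (MF) `9ε/4 ≤ Cov_T(Ṽ∘Θ₀, Ṽ)`;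
(RBLΔ-L²) `∫ (kerE_Q^{lift U}(Wᴿ) − kerE_Q^{lift U}(Ṽ) − p')² dμ_T(U) ≤ ε/4`; `0 < ε`.  Then
`ε ≤ Q2 G r β L s (θv) v`. [folklore] -/
theorem Q2_ge_of_bareFloor_l2 {β : ℝ} (hβ : 0 ≤ β) (c : Fin 4 → ℤ) (b L : ℕ) (hc0 : 1 ≤ c 0)
    (hcL : c 0 + (b : ℤ) + 3 ≤ L) (hc : ∀ j, -(L : ℤ) + 2 ≤ c j ∧ c j + (b : ℤ) + 2 ≤ (L : ℤ) + 1)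
    (s : ℝ) (v : 𝓢(EuclideanSpace ℝ (Fin 4), ℝ))
    (hsupp : ∀ x : Fin 4 → ℤ, v (s • siteToE x) ≠ 0 → x ∈ cubeSites c b ∧ 2 ≤ depth c b x)
    {p' ε : ℝ} (hε : 0 < ε)
    (hMF : 9 * ε / 4 ≤ torusE G r β L (fun V => (∑ y ∈ cubeSites c b, v (s • siteToE y) * dens G r y (cfgReflect V)) *
          ∑ y ∈ cubeSites c b, v (s • siteToE y) * dens G r y V) -
      torusE G r β L (fun V => ∑ y ∈ cubeSites c b, v (s • siteToE y) * dens G r y (cfgReflect V)) *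
        torusE G r β L (fun V => ∑ y ∈ cubeSites c b, v (s • siteToE y) * dens G r y V))
    (hΔ2 : torusE G r β L (fun V => (kerE G r β c b V (fun V => ∑ x ∈ cubeSites c b, v (s • siteToE x) *
        ∑ q : {q : Fin 4 × Fin 4 // q.1 < q.2}, plane G r q.1 (if q.1.1 = 0 then x - Pi.single 0 1 else x) V) -
      kerE G r β c b V (fun V => ∑ y ∈ cubeSites c b, v (s • siteToE y) * dens G r y V) - p') ^ 2) ≤ ε / 4) :
    ε ≤ Q2 G r β L s (thetaTest 4 v) v := by
  classical
  haveI := r.secondCountableTopology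
  haveI := isProbabilityMeasure_wilsonMeasure (d := 4) (L := 2 * L + 1) r.ρ r.continuous β
  -- the two cube-carried observables
  set W : LGConfig 4 G → ℝ := fun V => ∑ y ∈ cubeSites c b, v (s • siteToE y) * dens G r y V with hW
  set WR : LGConfig 4 G → ℝ := fun V => ∑ x ∈ cubeSites c b, v (s • siteToE x) *
    ∑ q : {q : Fin 4 × Fin 4 // q.1 < q.2}, plane G r q.1 (if q.1.1 = 0 then x - Pi.single 0 1 else x) V with hWR
  have hWc : Continuous W := continuous_cubeSmear G r c b _
  obtain ⟨MW, hMW⟩ := exists_abs_cubeSmear_le G r c b (fun y => v (s • siteToE y))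
  obtain ⟨SW, hWS, hSW⟩ := exists_isCylinder_cubeSmear G r c b (fun y => v (s • siteToE y))
  have hWRc : Continuous WR := continuous_reflSmear G r _ _
  obtain ⟨MR, hMR⟩ := exists_abs_reflSmear_le G r (cubeSites c b) (fun x => v (s • siteToE x))
  obtain ⟨SR, hRS, hSR⟩ := exists_isCylinder_reflSmear G r c b (fun x => v (s • siteToE x))
    fun x _ hx => (hsupp x hx).2
  -- the cube sits in the box
  have hsub : cubeSites c b ⊆ box 4 L := fun y hy => by
    rw [mem_box]
    intro j
    have h := (mem_cubeSites_iff _ _ _).1 hy j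
    have := hc j
    constructor <;> linarith [h.1, h.2]
  -- (1) `Q2 = Cov_T(Wᴿ∘Θ₀, Ṽ)`
  have hQ2 := Q2_thetaTest_eq_torusCov_reflSmear G r β L s v c b hsub fun x hx => (hsupp x hx).1
  -- (2) mirror factorisations
  have hfacR := torusCov_reflect_lift_eq_torusCov_reflect_kerE G r β c b L hc0 hcL hc hWRc hWc hMR hMW hRS hWS hSR hSW
  have hfacW := torusCov_reflect_lift_eq_torusCov_reflect_kerE G r β c b L hc0 hcL hc hWc hWc hMW hMW hWS hWS hSW hSW
  -- torus observables
  set m : GaugeConfig 4 (2 * L + 1) G → ℝ := fun U => kerE G r β c b (torusLift (2 * L + 1) U) W with hm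
  set mR : GaugeConfig 4 (2 * L + 1) G → ℝ := fun U => kerE G r β c b (torusLift (2 * L + 1) U) WR with hmR
  set D : GaugeConfig 4 (2 * L + 1) G → ℝ := fun U => mR U - m U - p' with hD
  have hmc : Continuous m := continuous_kerE_torusLift G r β c b (2 * L + 1) hWc hMW
  have hmb : ∀ U, |m U| ≤ MW := fun U => abs_kerE_le G r β c b _ hMW
  have hmRc : Continuous mR := continuous_kerE_torusLift G r β c b (2 * L + 1) hWRc hMR
  have hmRb : ∀ U, |mR U| ≤ MR := fun U => abs_kerE_le G r β c b _ hMR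
  have hDc : Continuous D := (hmRc.sub hmc).sub continuous_const
  have hDb : ∀ U, |D U| ≤ MR + MW + |p'| := fun U => by
    simp only [hD]
    calc |mR U - m U - p'| ≤ |mR U - m U| + |p'| := abs_sub _ _
      _ ≤ |mR U| + |m U| + |p'| := by linarith [abs_sub (mR U) (m U)]
      _ ≤ MR + MW + |p'| := by linarith [hmRb U, hmb U]
  -- non-negative-half dependence
  have hposm : DependsOn m {e : Edge 4 (2 * L + 1) | (e.1 0).val ≤ L ∧ ((e.1.shift e.2) 0).val ≤ L} :=
    dependsOn_posHalf_of_window L (isCylinder_kerE G r β c b hWc.measurable hWS) fun e he => by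
      have := kerE_supp_window hSW he 0
      constructor <;> linarith [this.1, this.2]
  have hposR : DependsOn mR {e : Edge 4 (2 * L + 1) | (e.1 0).val ≤ L ∧ ((e.1.shift e.2) 0).val ≤ L} :=
    dependsOn_posHalf_of_window L (isCylinder_kerE G r β c b hWRc.measurable hRS) fun e he => by
      have := kerE_supp_window hSR he 0
      constructor <;> linarith [this.1, this.2]
  have hposD : DependsOn D {e : Edge 4 (2 * L + 1) | (e.1 0).val ≤ L ∧ ((e.1.shift e.2) 0).val ≤ L} :=
    fun U V hUV => by simp only [hD, hposm hUV, hposR hUV]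
  have hL1 : 1 ≤ L := by linarith
  -- (3) reflection-positivity Cauchy–Schwarz for `(D, m)` and the MEAN-SQUARE bound on `B(D, D)`
  have hcs := sq_cov_negReflect_le_odd_pos (d := 4) (L := 2 * L + 1) r.ρ rfl hL1 r.continuous hβ
    hDc.measurable hmc.measurable ⟨MR + MW + |p'|, hDb⟩ ⟨MW, hmb⟩ hposD hposm
  have hdd := mirrorForm_le_l2sq (T := 2 * L + 1) r.ρ r.continuous β hDc.measurable hDb
  have hΔ2' : ∫ U, D U ^ 2 ∂(wilsonMeasure (d := 4) (L := 2 * L + 1) r.ρ β) ≤ ε / 4 := by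
    unfold torusE at hΔ2
    exact hΔ2
  have hdd' : (∫ U, D U.negReflect * D U ∂(wilsonMeasure (d := 4) (L := 2 * L + 1) r.ρ β)) -
      (∫ U, D U ∂(wilsonMeasure (d := 4) (L := 2 * L + 1) r.ρ β)) ^ 2 ≤ ε / 4 := hdd.trans hΔ2'
  -- integrability and invariance bookkeeping
  have hϑ : Measurable (GaugeConfig.negReflect : GaugeConfig 4 (2 * L + 1) G → GaugeConfig 4 (2 * L + 1) G) :=
    WilsonSiteRP.measurable_negReflect
  have im : Integrable m (wilsonMeasure (d := 4) (L := 2 * L + 1) r.ρ β) :=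
    integrable_wilson_of_bdd r.ρ r.continuous β hmc.measurable ⟨MW, hmb⟩
  have iD : Integrable D (wilsonMeasure (d := 4) (L := 2 * L + 1) r.ρ β) :=
    integrable_wilson_of_bdd r.ρ r.continuous β hDc.measurable ⟨MR + MW + |p'|, hDb⟩
  have imm : Integrable (fun U => m U.negReflect * m U) (wilsonMeasure (d := 4) (L := 2 * L + 1) r.ρ β) :=
    integrable_wilson_of_bdd r.ρ r.continuous β ((hmc.measurable.comp hϑ).mul hmc.measurable) ⟨MW * MW, fun U => by
      rw [abs_mul]; exact mul_le_mul (hmb _) (hmb _) (abs_nonneg _) ((abs_nonneg _).trans (hmb U))⟩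
  have iDm : Integrable (fun U => D U.negReflect * m U) (wilsonMeasure (d := 4) (L := 2 * L + 1) r.ρ β) :=
    integrable_wilson_of_bdd r.ρ r.continuous β ((hDc.measurable.comp hϑ).mul hmc.measurable)
      ⟨(MR + MW + |p'|) * MW, fun U => by
        rw [abs_mul]
        exact mul_le_mul (hDb _) (hmb _) (abs_nonneg _) ((abs_nonneg _).trans (hDb (U.negReflect)))⟩
  have hinvR : ∫ U, mR U.negReflect ∂(wilsonMeasure (d := 4) (L := 2 * L + 1) r.ρ β) =
      ∫ U, mR U ∂(wilsonMeasure (d := 4) (L := 2 * L + 1) r.ρ β) :=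
    integral_comp_negReflect_eq (d := 4) (L := 2 * L + 1) r.ρ r.continuous β mR
  have hinvm : ∫ U, m U.negReflect ∂(wilsonMeasure (d := 4) (L := 2 * L + 1) r.ρ β) =
      ∫ U, m U ∂(wilsonMeasure (d := 4) (L := 2 * L + 1) r.ρ β) :=
    integral_comp_negReflect_eq (d := 4) (L := 2 * L + 1) r.ρ r.continuous β m
  -- (4) `B(m_R, m) = B(m, m) + B(D, m)`
  have emR : ∀ U, mR U = m U + D U + p' := fun U => by simp only [hD]; ring
  have hsplit : (∫ U, mR U.negReflect * m U ∂(wilsonMeasure (d := 4) (L := 2 * L + 1) r.ρ β)) -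
      (∫ U, mR U ∂(wilsonMeasure (d := 4) (L := 2 * L + 1) r.ρ β)) *
        (∫ U, m U ∂(wilsonMeasure (d := 4) (L := 2 * L + 1) r.ρ β)) =
      ((∫ U, m U.negReflect * m U ∂(wilsonMeasure (d := 4) (L := 2 * L + 1) r.ρ β)) -
        (∫ U, m U ∂(wilsonMeasure (d := 4) (L := 2 * L + 1) r.ρ β)) ^ 2) +
      ((∫ U, D U.negReflect * m U ∂(wilsonMeasure (d := 4) (L := 2 * L + 1) r.ρ β)) -
        (∫ U, D U ∂(wilsonMeasure (d := 4) (L := 2 * L + 1) r.ρ β)) *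
          (∫ U, m U ∂(wilsonMeasure (d := 4) (L := 2 * L + 1) r.ρ β))) := by
    have e1 : (fun U => mR U.negReflect * m U) =
        fun U => (m U.negReflect * m U + D U.negReflect * m U) + p' * m U := by
      funext U; rw [emR]; ring
    have e2 : (fun U => mR U) = fun U => (m U + D U) + p' := by funext U; rw [emR]
    have i1 : Integrable (fun U => m U.negReflect * m U + D U.negReflect * m U)
        (wilsonMeasure (d := 4) (L := 2 * L + 1) r.ρ β) := imm.add iDm
    have i2 : Integrable (fun U => p' * m U) (wilsonMeasure (d := 4) (L := 2 * L + 1) r.ρ β) := im.const_mul p'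
    have i3 : Integrable (fun U => m U + D U) (wilsonMeasure (d := 4) (L := 2 * L + 1) r.ρ β) := im.add iD
    rw [e1, integral_add i1 i2, integral_add imm iDm, integral_const_mul]
    rw [show (∫ U, mR U ∂(wilsonMeasure (d := 4) (L := 2 * L + 1) r.ρ β)) =
        ∫ U, (fun U => (m U + D U) + p') U ∂(wilsonMeasure (d := 4) (L := 2 * L + 1) r.ρ β) by rw [← e2],
      integral_add i3 (integrable_const _), integral_add im iD, integral_const, smul_eq_mul, probReal_univ]
    ring
  -- assemble
  rw [hQ2, hfacR]
  unfold torusE at hfacW hMF ⊢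
  simp only [← torusLift_negReflect] at hfacW hMF ⊢
  change ε ≤ (∫ U, mR U.negReflect * m U ∂(wilsonMeasure (d := 4) (L := 2 * L + 1) r.ρ β)) -
    (∫ U, mR U.negReflect ∂(wilsonMeasure (d := 4) (L := 2 * L + 1) r.ρ β)) *
      (∫ U, m U ∂(wilsonMeasure (d := 4) (L := 2 * L + 1) r.ρ β))
  rw [hinvR, hsplit]
  rw [hfacW] at hMF
  change 9 * ε / 4 ≤ (∫ U, m U.negReflect * m U ∂(wilsonMeasure (d := 4) (L := 2 * L + 1) r.ρ β)) -
    (∫ U, m U.negReflect ∂(wilsonMeasure (d := 4) (L := 2 * L + 1) r.ρ β)) *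
      (∫ U, m U ∂(wilsonMeasure (d := 4) (L := 2 * L + 1) r.ρ β)) at hMF
  rw [hinvm, ← sq] at hMF
  exact chiral_floor_arith hMF hcs hdd' hε

/-- **Converse with the defect in mean square (fixed `β ≥ 0`, torus `2L+1`).**  Same geometry; (RBLΔ-L²) as above
and a floor `ε ≤ Q2 G r β L s (θv) v`, `0 < ε`.  Then `ε/2 ≤ Cov_T(Ṽ∘Θ₀, Ṽ)` — reflection positivity
`B(m, m) ≥ 0` on the odd torus (`CurvatureKernel.OddTorusCovCauchySchwarz`) and `bare_floor_arith`. [folklore] -/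
theorem bareFloor_of_Q2_floor_l2 {β : ℝ} (hβ : 0 ≤ β) (c : Fin 4 → ℤ) (b L : ℕ) (hc0 : 1 ≤ c 0)
    (hcL : c 0 + (b : ℤ) + 3 ≤ L) (hc : ∀ j, -(L : ℤ) + 2 ≤ c j ∧ c j + (b : ℤ) + 2 ≤ (L : ℤ) + 1)
    (s : ℝ) (v : 𝓢(EuclideanSpace ℝ (Fin 4), ℝ))
    (hsupp : ∀ x : Fin 4 → ℤ, v (s • siteToE x) ≠ 0 → x ∈ cubeSites c b ∧ 2 ≤ depth c b x)
    {p' ε : ℝ} (hε : 0 < ε)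
    (hΔ2 : torusE G r β L (fun V => (kerE G r β c b V (fun V => ∑ x ∈ cubeSites c b, v (s • siteToE x) *
        ∑ q : {q : Fin 4 × Fin 4 // q.1 < q.2}, plane G r q.1 (if q.1.1 = 0 then x - Pi.single 0 1 else x) V) -
      kerE G r β c b V (fun V => ∑ y ∈ cubeSites c b, v (s • siteToE y) * dens G r y V) - p') ^ 2) ≤ ε / 4)
    (hQ : ε ≤ Q2 G r β L s (thetaTest 4 v) v) :
    ε / 2 ≤ torusE G r β L (fun V => (∑ y ∈ cubeSites c b, v (s • siteToE y) * dens G r y (cfgReflect V)) *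
          ∑ y ∈ cubeSites c b, v (s • siteToE y) * dens G r y V) -
      torusE G r β L (fun V => ∑ y ∈ cubeSites c b, v (s • siteToE y) * dens G r y (cfgReflect V)) *
        torusE G r β L (fun V => ∑ y ∈ cubeSites c b, v (s • siteToE y) * dens G r y V) := by
  classical
  haveI := r.secondCountableTopology
  haveI := isProbabilityMeasure_wilsonMeasure (d := 4) (L := 2 * L + 1) r.ρ r.continuous β
  set W : LGConfig 4 G → ℝ := fun V => ∑ y ∈ cubeSites c b, v (s • siteToE y) * dens G r y V with hW
  set WR : LGConfig 4 G → ℝ := fun V => ∑ x ∈ cubeSites c b, v (s • siteToE x) *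
    ∑ q : {q : Fin 4 × Fin 4 // q.1 < q.2}, plane G r q.1 (if q.1.1 = 0 then x - Pi.single 0 1 else x) V with hWR
  have hWc : Continuous W := continuous_cubeSmear G r c b _
  obtain ⟨MW, hMW⟩ := exists_abs_cubeSmear_le G r c b (fun y => v (s • siteToE y))
  obtain ⟨SW, hWS, hSW⟩ := exists_isCylinder_cubeSmear G r c b (fun y => v (s • siteToE y))
  have hWRc : Continuous WR := continuous_reflSmear G r _ _
  obtain ⟨MR, hMR⟩ := exists_abs_reflSmear_le G r (cubeSites c b) (fun x => v (s • siteToE x))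
  obtain ⟨SR, hRS, hSR⟩ := exists_isCylinder_reflSmear G r c b (fun x => v (s • siteToE x))
    fun x _ hx => (hsupp x hx).2
  have hsub : cubeSites c b ⊆ box 4 L := fun y hy => by
    rw [mem_box]
    intro j
    have h := (mem_cubeSites_iff _ _ _).1 hy j
    have := hc j
    constructor <;> linarith [h.1, h.2]
  have hQ2 := Q2_thetaTest_eq_torusCov_reflSmear G r β L s v c b hsub fun x hx => (hsupp x hx).1
  have hfacR := torusCov_reflect_lift_eq_torusCov_reflect_kerE G r β c b L hc0 hcL hc hWRc hWc hMR hMW hRS hWS hSR hSW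
  have hfacW := torusCov_reflect_lift_eq_torusCov_reflect_kerE G r β c b L hc0 hcL hc hWc hWc hMW hMW hWS hWS hSW hSW
  set m : GaugeConfig 4 (2 * L + 1) G → ℝ := fun U => kerE G r β c b (torusLift (2 * L + 1) U) W with hm
  set mR : GaugeConfig 4 (2 * L + 1) G → ℝ := fun U => kerE G r β c b (torusLift (2 * L + 1) U) WR with hmR
  set D : GaugeConfig 4 (2 * L + 1) G → ℝ := fun U => mR U - m U - p' with hD
  have hmc : Continuous m := continuous_kerE_torusLift G r β c b (2 * L + 1) hWc hMW
  have hmb : ∀ U, |m U| ≤ MW := fun U => abs_kerE_le G r β c b _ hMW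
  have hmRc : Continuous mR := continuous_kerE_torusLift G r β c b (2 * L + 1) hWRc hMR
  have hmRb : ∀ U, |mR U| ≤ MR := fun U => abs_kerE_le G r β c b _ hMR
  have hDc : Continuous D := (hmRc.sub hmc).sub continuous_const
  have hDb : ∀ U, |D U| ≤ MR + MW + |p'| := fun U => by
    simp only [hD]
    calc |mR U - m U - p'| ≤ |mR U - m U| + |p'| := abs_sub _ _
      _ ≤ |mR U| + |m U| + |p'| := by linarith [abs_sub (mR U) (m U)]
      _ ≤ MR + MW + |p'| := by linarith [hmRb U, hmb U]
  have hposm : DependsOn m {e : Edge 4 (2 * L + 1) | (e.1 0).val ≤ L ∧ ((e.1.shift e.2) 0).val ≤ L} :=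
    dependsOn_posHalf_of_window L (isCylinder_kerE G r β c b hWc.measurable hWS) fun e he => by
      have := kerE_supp_window hSW he 0
      constructor <;> linarith [this.1, this.2]
  have hposR : DependsOn mR {e : Edge 4 (2 * L + 1) | (e.1 0).val ≤ L ∧ ((e.1.shift e.2) 0).val ≤ L} :=
    dependsOn_posHalf_of_window L (isCylinder_kerE G r β c b hWRc.measurable hRS) fun e he => by
      have := kerE_supp_window hSR he 0
      constructor <;> linarith [this.1, this.2]
  have hposD : DependsOn D {e : Edge 4 (2 * L + 1) | (e.1 0).val ≤ L ∧ ((e.1.shift e.2) 0).val ≤ L} :=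
    fun U V hUV => by simp only [hD, hposm hUV, hposR hUV]
  have hL1 : 1 ≤ L := by linarith
  have hcs := sq_cov_negReflect_le_odd_pos (d := 4) (L := 2 * L + 1) r.ρ rfl hL1 r.continuous hβ
    hDc.measurable hmc.measurable ⟨MR + MW + |p'|, hDb⟩ ⟨MW, hmb⟩ hposD hposm
  have hdd := mirrorForm_le_l2sq (T := 2 * L + 1) r.ρ r.continuous β hDc.measurable hDb
  have hΔ2' : ∫ U, D U ^ 2 ∂(wilsonMeasure (d := 4) (L := 2 * L + 1) r.ρ β) ≤ ε / 4 := by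
    unfold torusE at hΔ2
    exact hΔ2
  have hdd' : (∫ U, D U.negReflect * D U ∂(wilsonMeasure (d := 4) (L := 2 * L + 1) r.ρ β)) -
      (∫ U, D U ∂(wilsonMeasure (d := 4) (L := 2 * L + 1) r.ρ β)) ^ 2 ≤ ε / 4 := hdd.trans hΔ2'
  have hX0 : 0 ≤ (∫ U, m U.negReflect * m U ∂(wilsonMeasure (d := 4) (L := 2 * L + 1) r.ρ β)) -
      (∫ U, m U ∂(wilsonMeasure (d := 4) (L := 2 * L + 1) r.ρ β)) ^ 2 := by
    have h := (OddTorusCovCauchySchwarz G r.N r.ρ r.continuous β hβ L hL1 m m hmc.measurable hmc.measurable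
      ⟨MW, hmb⟩ ⟨MW, hmb⟩ (dependsOn_strictHalf_of_posHalf hL1 hposm) (dependsOn_strictHalf_of_posHalf hL1 hposm)).1
    rw [← sq] at h
    exact h
  have hϑ : Measurable (GaugeConfig.negReflect : GaugeConfig 4 (2 * L + 1) G → GaugeConfig 4 (2 * L + 1) G) :=
    WilsonSiteRP.measurable_negReflect
  have im : Integrable m (wilsonMeasure (d := 4) (L := 2 * L + 1) r.ρ β) :=
    integrable_wilson_of_bdd r.ρ r.continuous β hmc.measurable ⟨MW, hmb⟩
  have iD : Integrable D (wilsonMeasure (d := 4) (L := 2 * L + 1) r.ρ β) :=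
    integrable_wilson_of_bdd r.ρ r.continuous β hDc.measurable ⟨MR + MW + |p'|, hDb⟩
  have imm : Integrable (fun U => m U.negReflect * m U) (wilsonMeasure (d := 4) (L := 2 * L + 1) r.ρ β) :=
    integrable_wilson_of_bdd r.ρ r.continuous β ((hmc.measurable.comp hϑ).mul hmc.measurable) ⟨MW * MW, fun U => by
      rw [abs_mul]; exact mul_le_mul (hmb _) (hmb _) (abs_nonneg _) ((abs_nonneg _).trans (hmb U))⟩
  have iDm : Integrable (fun U => D U.negReflect * m U) (wilsonMeasure (d := 4) (L := 2 * L + 1) r.ρ β) :=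
    integrable_wilson_of_bdd r.ρ r.continuous β ((hDc.measurable.comp hϑ).mul hmc.measurable)
      ⟨(MR + MW + |p'|) * MW, fun U => by
        rw [abs_mul]
        exact mul_le_mul (hDb _) (hmb _) (abs_nonneg _) ((abs_nonneg _).trans (hDb (U.negReflect)))⟩
  have hinvR : ∫ U, mR U.negReflect ∂(wilsonMeasure (d := 4) (L := 2 * L + 1) r.ρ β) =
      ∫ U, mR U ∂(wilsonMeasure (d := 4) (L := 2 * L + 1) r.ρ β) :=
    integral_comp_negReflect_eq (d := 4) (L := 2 * L + 1) r.ρ r.continuous β mR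
  have hinvm : ∫ U, m U.negReflect ∂(wilsonMeasure (d := 4) (L := 2 * L + 1) r.ρ β) =
      ∫ U, m U ∂(wilsonMeasure (d := 4) (L := 2 * L + 1) r.ρ β) :=
    integral_comp_negReflect_eq (d := 4) (L := 2 * L + 1) r.ρ r.continuous β m
  have emR : ∀ U, mR U = m U + D U + p' := fun U => by simp only [hD]; ring
  have hsplit : (∫ U, mR U.negReflect * m U ∂(wilsonMeasure (d := 4) (L := 2 * L + 1) r.ρ β)) -
      (∫ U, mR U ∂(wilsonMeasure (d := 4) (L := 2 * L + 1) r.ρ β)) *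
        (∫ U, m U ∂(wilsonMeasure (d := 4) (L := 2 * L + 1) r.ρ β)) =
      ((∫ U, m U.negReflect * m U ∂(wilsonMeasure (d := 4) (L := 2 * L + 1) r.ρ β)) -
        (∫ U, m U ∂(wilsonMeasure (d := 4) (L := 2 * L + 1) r.ρ β)) ^ 2) +
      ((∫ U, D U.negReflect * m U ∂(wilsonMeasure (d := 4) (L := 2 * L + 1) r.ρ β)) -
        (∫ U, D U ∂(wilsonMeasure (d := 4) (L := 2 * L + 1) r.ρ β)) *
          (∫ U, m U ∂(wilsonMeasure (d := 4) (L := 2 * L + 1) r.ρ β))) := by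
    have e1 : (fun U => mR U.negReflect * m U) =
        fun U => (m U.negReflect * m U + D U.negReflect * m U) + p' * m U := by
      funext U; rw [emR]; ring
    have e2 : (fun U => mR U) = fun U => (m U + D U) + p' := by funext U; rw [emR]
    have i1 : Integrable (fun U => m U.negReflect * m U + D U.negReflect * m U)
        (wilsonMeasure (d := 4) (L := 2 * L + 1) r.ρ β) := imm.add iDm
    have i2 : Integrable (fun U => p' * m U) (wilsonMeasure (d := 4) (L := 2 * L + 1) r.ρ β) := im.const_mul p'
    have i3 : Integrable (fun U => m U + D U) (wilsonMeasure (d := 4) (L := 2 * L + 1) r.ρ β) := im.add iD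
    rw [e1, integral_add i1 i2, integral_add imm iDm, integral_const_mul]
    rw [show (∫ U, mR U ∂(wilsonMeasure (d := 4) (L := 2 * L + 1) r.ρ β)) =
        ∫ U, (fun U => (m U + D U) + p') U ∂(wilsonMeasure (d := 4) (L := 2 * L + 1) r.ρ β) by rw [← e2],
      integral_add i3 (integrable_const _), integral_add im iD, integral_const, smul_eq_mul, probReal_univ]
    ring
  -- assemble
  rw [hQ2, hfacR] at hQ
  unfold torusE at hfacW hQ ⊢
  simp only [← torusLift_negReflect] at hfacW hQ ⊢
  change ε ≤ (∫ U, mR U.negReflect * m U ∂(wilsonMeasure (d := 4) (L := 2 * L + 1) r.ρ β)) -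
    (∫ U, mR U.negReflect ∂(wilsonMeasure (d := 4) (L := 2 * L + 1) r.ρ β)) *
      (∫ U, m U ∂(wilsonMeasure (d := 4) (L := 2 * L + 1) r.ρ β)) at hQ
  rw [hinvR, hsplit] at hQ
  rw [hfacW]
  change ε / 2 ≤ (∫ U, m U.negReflect * m U ∂(wilsonMeasure (d := 4) (L := 2 * L + 1) r.ρ β)) -
    (∫ U, m U.negReflect ∂(wilsonMeasure (d := 4) (L := 2 * L + 1) r.ρ β)) *
      (∫ U, m U ∂(wilsonMeasure (d := 4) (L := 2 * L + 1) r.ρ β))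
  rw [hinvm, ← sq]
  exact bare_floor_arith hε hX0 hQ hcs hdd'

end Typical

end Summit.QuantumFields.YangMills.Cruxes.NT.MarkovMirror

end
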